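import Mathlib
import Summits.ResolutionOfSingularities.ResolutionOfSingularities.Theses.EscapeRate
import Summits.ResolutionOfSingularities.ResolutionOfSingularities.Theorems.LinearCodimGrowth.Negative.EternalFamily

/-!
# Refutation of `EscapeRate.LinearCodimGrowth` (item stmt-ResolutionOfSingularities-18128)

Point blow-ups create positive-dimensional multiplicity-`p` loci, which persist for ever at no
cost: for `(p, n) = (2, 2)` every start with `ord (clean c₀) ≥ 4` becomes `x² · b` after one
blow-up, and the exceptional line `x = 0` is then a curve of double points.  The eternal family and
its bookkeeping are `LinearCodimGrowth.Negative.eternal_family`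
(`Theorems/LinearCodimGrowth/Negative/EternalFamily.lean`).
-/

/-- **Record of the dropped route item `LinearCodimGrowth`** = stmt-ResolutionOfSingularities-18128 (ledger signature verbatim; NOT a route
item): route EscapeRate rev 8 (2026-08-17T14:40Z) replaced the refuted `LinearCodimGrowth` (stmt-18128) by the repaired stmt-18231 under a new name. The declaration `Summit.ResolutionOfSingularities.ResolutionOfSingularities.Theses.EscapeRate.LinearCodimGrowth`
therefore no longer exists in the route file and this accepted module stopped elaborating (stale olean;
buildfix lane 2026-08-19). Re-created here under its original name so the result keeps building; the
statement of every previously accepted declaration in this file is unchanged. -/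
def _root_.Summit.ResolutionOfSingularities.ResolutionOfSingularities.Theses.EscapeRate.LinearCodimGrowth : Prop :=
  ∀ p : ℕ, p.Prime → ∀ n : ℕ, 0 < n → ∃ a b C : ℕ, 0 < a ∧ 0 < b ∧ ∀ N M : ℕ, p * (N + 2) ≤ M → ∃ r₀ : ℕ, ∀ (κ : Type) [Field κ] [Fintype κ] [CharP κ p], p ^ r₀ ≤ Fintype.card κ → let L := AlgebraicClosure κ; let clean : ((Fin n → ℕ) → L) → ((Fin n → ℕ) → L) := fun c A => @ite L (∀ j, p ∣ A j) (Classical.dec _) 0 (c A); let bl : Fin n → ((Fin n → ℕ) → L) → ((Fin n → ℕ) → L) := fun i c B => @ite L (Finset.sum (Finset.univ.erase i) (fun j => B j) ≤ B i) (Classical.dec _) (c (Function.update B i (B i - Finset.sum (Finset.univ.erase i) (fun j => B j)))) 0; let ord : ((Fin n → ℕ) → L) → ℕ := fun c => sInf {m : ℕ | ∃ A, c A ≠ 0 ∧ m = Finset.sum Finset.univ (fun j => A j)}; let dv : Fin n → ℕ → ((Fin n → ℕ) → L) → ((Fin n → ℕ) → L) := fun i s c B => c (Function.update B i (B i + s));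 let tr : Fin n → (Fin n → L) → ℕ → ((Fin n → ℕ) → L) → ((Fin n → ℕ) → L) := fun i τ s c B => Finset.sum (Fintype.piFinset (fun _ : Fin n => Finset.range (B i + s + 1))) (fun D => @ite L (D i = 0) (Classical.dec _) (c (B + D) * Finset.prod (Finset.univ.erase i) (fun j => ((Nat.choose (B j + D j) (B j) : ℕ) : L) * τ j ^ (D j))) 0); let step : Fin n → (Fin n → L) → ((Fin n → ℕ) → L) → ((Fin n → ℕ) → L) := fun i τ c => clean (tr i τ (@ite ℕ (p ≤ ord (clean c)) (Classical.dec _) p 0) (dv i (@ite ℕ (p ≤ ord (clean c)) (Classical.dec _) p 0) (bl i (clean c)))); let run : ((Fin n → ℕ) → L) → (ℕ → Fin n) → (ℕ → Fin n → L) → ℕ → ((Fin n → ℕ) → L) := fun c₀ i t m => @Nat.rec (fun _ => (Fin n → ℕ) → L) c₀ (fun m c => step (i m) (t m) c) m; let MultP : ((Fin n → ℕ) → L) → Prop := fun c => (∃ A, clean c A ≠ 0) ∧ ∀ A, clean c A ≠ 0 → p ≤ Finset.sum Finset.univ (fun j => A j); let Persist : ((Fin n → ℕ) → κ) → Prop :=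 fun c₀ => ∃ (i : ℕ → Fin n) (t : ℕ → Fin n → L), ∀ m, m ≤ N → MultP (run (fun A => algebraMap κ L (c₀ A)) i t m); let Supp : ((Fin n → ℕ) → κ) → Prop := fun c₀ => ∀ A : Fin n → ℕ, M < Finset.sum Finset.univ (fun j => A j) → c₀ A = 0; ∀ F : Finset ((Fin n → ℕ) → κ), (∀ c₀ ∈ F, Supp c₀ ∧ Persist c₀) → F.card ^ b * Fintype.card κ ^ (a * N) ≤ Fintype.card κ ^ (b * (C + Nat.choose (M + n) n))


set_option linter.dupNamespace false -- mandated namespace `Summit.<S>.<S>.Theorems` of this single-conjunct summit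

namespace Summit.ResolutionOfSingularities.ResolutionOfSingularities.Theorems

/-- Refutes `EscapeRate.LinearCodimGrowth` [refuted-misstated]: the claimed linear codimension
growth of the `N`-step persistence locus is false already for `(p, n) = (2, 2)`.
Witness: the starts `c₀` with `ord (clean c₀) ≥ 4` (we even drop all monomials of degree `< 4`
and fix the coefficient of `x⁵` to `1`; codimension `≤ 17`, independent of `N`) persist for EVERY
`N` along the word (`x`-chart, then `y`-chart for ever, all translations `0`): after one blow-up the
state is `x² b`, i.e. `z² = x² b` has the whole exceptional line as a curve of double points, and a
positive-dimensional multiplicity-`p` locus persists under point blow-ups for free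
(`LinearCodimGrowth.Negative.eternal_family`: `q ^ C(M+2,2) ≤ |F| · q ^ 17` with `Supp ∧ Persist`
on `F`).  Hence `|F|^b q^(aN) ≤ q^(b (C + C(M+2,2)))` fails at `N = b (C + 17) + 1`,
`M = 2 (N + 2)`, `κ = GaloisField 2 (r₀ + 1)`.
The same mechanism (cleaned order `≥ 2p`, track `x^(2p+1)`) kills every `(p, n)` with `n ≥ 2`.
Repaired statement `C′` (believed intended, untested): add isolatedness of every state, i.e. replace
`MultP (run … m)` in `Persist` by `Isol (run … m) ∧ MultP (run … m)` with `Isol` the finite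
Jacobian-colength predicate of the target `IsolatedForcedTermination` (stmt-16343); the witness
misses `C′` (its state 1, `z² = x² b`, is not isolated). [folklore] -/
theorem EscapeRateLinearCodimGrowth_refuted :
    ¬ Summit.ResolutionOfSingularities.ResolutionOfSingularities.Theses.EscapeRate.LinearCodimGrowth := by
  intro h
  obtain ⟨a, b, C, ha, hb, h⟩ := h 2 Nat.prime_two 2 two_pos
  obtain ⟨r₀, h⟩ := h (b * (C + 17) + 1) (2 * (b * (C + 17) + 1 + 2)) le_rfl
  haveI : Fact (Nat.Prime 2) := ⟨Nat.prime_two⟩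
  letI : Fintype (GaloisField 2 (r₀ + 1)) := Fintype.ofFinite _
  have hcard : Fintype.card (GaloisField 2 (r₀ + 1)) = 2 ^ (r₀ + 1) := by
    rw [← Nat.card_eq_fintype_card]
    exact GaloisField.card 2 (r₀ + 1) (Nat.succ_ne_zero _)
  have hq : 2 ^ r₀ ≤ Fintype.card (GaloisField 2 (r₀ + 1)) := by
    rw [hcard]
    exact Nat.pow_le_pow_right two_pos (Nat.le_succ _)
  have h2q : 1 < Fintype.card (GaloisField 2 (r₀ + 1)) := by
    rw [hcard]
    exact Nat.one_lt_two_pow (Nat.succ_ne_zero _)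
  set N := b * (C + 17) + 1 with hN
  set M := 2 * (N + 2) with hM
  set q := Fintype.card (GaloisField 2 (r₀ + 1)) with hqdef
  obtain ⟨F, hF, hbig⟩ :=
    LinearCodimGrowth.Negative.eternal_family (GaloisField 2 (r₀ + 1)) N M (by omega)
  have h6 : F.card ^ b * q ^ (a * N) ≤ q ^ (b * (C + Nat.choose (M + 2) 2)) :=
    h (GaloisField 2 (r₀ + 1)) hq F hF
  -- `q ^ (C(M+2,2) · b + a N) ≤ |F|^b q^(a N) q^(17 b) ≤ q ^ (b (C + C(M+2,2)) + 17 b)`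
  have e1 : q ^ (Nat.choose (M + 2) 2 * b) * q ^ (a * N) ≤
      F.card ^ b * q ^ (a * N) * q ^ (17 * b) := by
    have := Nat.pow_le_pow_left hbig b
    rw [mul_pow, ← pow_mul, ← pow_mul] at this
    calc q ^ (Nat.choose (M + 2) 2 * b) * q ^ (a * N)
        ≤ F.card ^ b * q ^ (17 * b) * q ^ (a * N) := Nat.mul_le_mul_right _ this
      _ = F.card ^ b * q ^ (a * N) * q ^ (17 * b) := by ring
  have e2 := e1.trans (Nat.mul_le_mul_right _ h6)
  rw [← pow_add, ← pow_add] at e2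
  have hlt : b * (C + Nat.choose (M + 2) 2) + 17 * b < Nat.choose (M + 2) 2 * b + a * N := by
    have f2 : N ≤ a * N := Nat.le_mul_of_pos_left N ha
    have f3 : b * (C + 17) = b * C + b * 17 := Nat.mul_add b C 17
    rw [Nat.mul_add, Nat.mul_comm (Nat.choose (M + 2) 2) b]
    omega
  exact absurd e2 (not_le.2 (Nat.pow_lt_pow_right h2q hlt))

end Summit.ResolutionOfSingularities.ResolutionOfSingularities.Theorems
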